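import Summits.QuantumFields.YangMills.Theorems.BalabanUVNodesN19SizeWindowNodes
import Summits.QuantumFields.YangMills.Theorems.BalabanUVNodesN17Knit
import Literature.MathematicalPhysics.QuantumFieldTheory.Balaban1983to89.T4ApexHybrid
import Literature.MathematicalPhysics.QuantumFieldTheory.Balaban1983to89.T4ContinuumYM4Torus

/-!
# BalabanUVNodes ∕ N27 spine-record join — DAG node N27 (binder B5, «the nine spine estimates packaged») AT THE DATUM,
# FROM THE SPINE'S STATEMENTS OF RECORD BY NAME: N16 `NE3Shape` · N17 (its out-edge `Spine.NE4.U2Output D` under the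
# prefix, or `NE4OnData D` itself) · N18 `NE5` · N22 `NE9 ∧ FadingMemory` · N20 `RelWeightBound` · N21 `ShellWeightBound`
# · the E1∕E2 dictionary · the (2.25)-ledger link, the two runs' coupling tables being THE DATUM'S OWN RUNS
# `Spine.NE4.runFlow D g₀` with the box bounds READ OFF the prefix's `Tuned` ⇒ `T4ApexHybrid.HybridNE7Under D Hβ`

Cell `pub-ymgap`, HUMAN RULING D-0062 (YM Track A at full width), seat `pub-ymgap-dag-n27-a` generation g2 (KNIT-BY-NAME seat of
node N27; ROSTER-D0062 row n27 «keep `HybridNE7` fillable from n14–n22's record decls»; chair R432: `--supports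
stmt-QuantumFields-19182`, nothing here closes a rev-0 item; count-neutral).  Companion of
`BalabanUVNodesSpineGivenEndpointN27` (g0, p409417: the glue with the three K5 children N19 · N20 · N21 as OPAQUE hypotheses,
its faithfulness, the K4-guarded form with K4 ABSTRACT).  THIS module replaces the opaque N19 hypothesis and the abstract K4 by
the sibling seats' LANDED knits, so that B5 is concluded from the statements of record of the in-edges of its in-edges:

  N16 ─┐                                   ┌─ N20 (weight)
  N18 ─┼─ n19-b `core_summable_of_nodes_polySize` (U2-OUTPUT letter) ─ N19 ∧ U4′ (core, summable) ─┐
  N22 ─┤                                   │                                                      ├─ `HybridNE7` ─ E1∕E2 ─ `StringHybridNE7`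
  N17 ─┘ via `U2Output D g₀` (n17-a)        └─ N21 (shell), `W + Wsh < 1` ───────────────────────────┘      (per string, per tuned `g₀`)
  ⟹ under the targets' prefix, thresholds conjoined (`ForSmallCouplings.and`): `T4ApexHybrid.HybridNE7Under D Hβ` = B5 at `Hβ := END`.

WHAT IS KERNEL-CHECKED ([bookkeeping] ∕ [folklore] throughout: composition of landed tree theorems BY NAME; 0 `def`, 0 `sorry`).
* §1 `stringHybridNE7_of_spineRecord` — ONE STRING of one `TorusScheme`, explicit carriers, abstract coupling tables `g K`
  (run A at cutoff `K₀ + K`) ∕ `i ↦ g (K+1) (i+1)` (run B): N20 · N21 · `W + Wsh < 1` · E1∕E2 · N16 `T4EtaRateMin.NE3Shape` (+ the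
  liaison `GaugeDominated`) · N18 `T4OutputRate.NE5` · N22 `T4OutputRate.NE9 ∧ FadingMemory` · node U3's printed-ingredient bracket
  `LipBackground`∕`PolyLipGrowth` · N17's out-edge in node U2's OUTPUT letter `T4CauchySum.InjectedRate Cd 0 θc (disc (g K) (g (K+1)))`
  · the box, the window memberships, the rate ordering · the (2.25)-LEDGER LINK (term format of the shell-free cores as pending positive
  integrals, integrability, scales, positivity∕vanishing of the other kinds, one-run size centring in the (2.43)-window profile
  `S ≤ vol·E₀(K+1)^m·a^{K−j}`, multiplicity, other kinds' centring with summable aggregate `rO`, hazard H-U5b-1 uniformly in the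
  tower constant) ⇒ `T4MatchingAssembly.StringHybridNE7 S os l₀ vol K₀` — `N19SizeWindow.core_summable_of_nodes_polySize` (dag-n19-b
  p409886) then `Spine.NE7.hybridNE7_of_core` (the K5 constructor, as in dag-n19-a's `N19CoreKnit.hybridNE7_of_core_exists`) then
  packaging; `stringHybridNE7_of_spineNodes_exists` — the same with N19 ∧ U4′ opaque in the form the N19 knits deliver it
  (`∃ δ, Spine.NE7.Core … δ ∧ Summable δ`).
* §2 `hybridNE7Under_of_spineRecordAtDatum` — THE N27 JOIN AT THE DATUM `D` (any finite-`ε` datum, any β-binder `Hβ`): the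
  string-independent record decls N16 `NE3Shape R C₃ θ₃`, N18 `NE5 EA EB W κ θ₅ C₅`, N22 `NE9 EA W κ Λ ∧ FadingMemory C₉ ω Λ`,
  `LipBackground`, `GaugeDominated` as TOP-LEVEL hypotheses; N17's out-edge to N27 EXACTLY as dag-n17-a's `N17Knit.u2Output_under_of_u3edge`
  ∕ `nodeU2_of_N17` conclude it, `D.UnderHypotheses Hβ (fun g₀ ↦ Spine.NE4.U2Output D g₀ Cd θc)`; and, under the same prefix, per
  string `os` at carriers read as functions of `(g₀, os)`: K5's N20 ∧ N21 ∧ budget, the E1∕E2 dictionary against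
  `T4GenFunBounds.schemeZ (D.scheme g₀) os (K₀ + K)`, the run-dependent K4 clauses (`PolyLipGrowth`, window memberships) and the
  ledger link — ALL AT THE DATUM'S RUNS `g K := Spine.NE4.runFlow D g₀ (K₀ + K)` (the coupling flow of the `(K₀+K)`-step run of `D.C`
  from the tuned bare coupling `g₀ (K₀+K)`); the box `0 < g K i ≤ γ` (`i ≤ K`) is READ OFF `D.Tuned γ g g₀` inside the proof, not
  asked.  ⇒ `T4ApexHybrid.HybridNE7Under D Hβ`.  (Companion module `BalabanUVNodesN27SpineRecordJoinN17`:
  `hybridNE7Under_of_spineRecordAtDatum_of_N17` — the same with N17 ITSELF by name, `Spine.NE4.NE4OnData D c θ γᵤ`, plus the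
  regularity ∕ printed-type β-side binders of dag-n17-a's `nodeU2_of_N17` producing the out-edge; split for the 400-line limit.)
* §3 `injectedRate_shift` — node U2's output along `g₀` restricts to the runs from `K₀` on (bookkeeping used in §2).

THE FIELD-BY-FIELD TABLE OF `T4MatchingAssembly.HybridNE7` (:146), REFRESHED 2026-08-25T23:30Z (g0's table: module docstring of
`BalabanUVNodesSpineGivenEndpointN27`; «at D₀» = at Bałaban's datum of record — NODE 00 Stage 5 `Node00.Record5` p410529
`datumOfRecord₅`∕`IsRecordOfRecord₅`, ₅C intent, ₇∕₈ definers filing; NOTHING below is instantiated on it):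
* `weight` ← N20 (NE7b) `T4WeightBudget.RelWeightBound`.  NEW: dag-n20-a `BalabanUVNodesN20Knit` p409854 (`relWeightBound_of_extractionLaws`
  — two runs' `NE7b.PinnedExtraction.ExtractionLaws` over the same bad classes + counts ⇒ N20 at EXACT carriers; `relWeightBound_of_towerExtraction_shifted`
  — N20 at the (α) road's tower record, `∃ K₁`-shifted carriers) and `…N20KnitDerived` p410322 (count DERIVED under `BetaPertHyp`; toy
  saturation negative `not_exists_relWeightBound_toy_saturated`).  At D₀: 0∕1 (Bałaban's tower object not instantiated; NC-NE7b-α unruled).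
* `shell` ← N21 (NE7c) `T4IndicatorShell.ShellWeightBound`.  NEW: dag-n21-a `…N21ShellWeightKnit` p408928 (`n21_knit_levels`∕`_ages` from
  level∕age ledgers, `shellWeightBound_mono`∕`_of_le_geometric`), `…N21ShellFactorJunction` p409431, `…N21ClosenessJunction` p410611
  (`shell_domination_of_n16`, `n21_knit_levels_of_n16Width`: N16's width feeds N21 — an in-edge N16 → N21 in kernel).  At D₀: 0∕1.
* `lt_one` ← U4′; unchanged (`T4MatchingClosure.eventually_budget_lt_one` in the tail).
* `summable` ← NOW DELIVERED TOGETHER WITH `core` by the N19 knits, `δ K = max(Cw,1)(E₀(K+1)^m + Cr)Σ_{j+n=K} min(aⁿ, θ′^jΛⁿ) + rO K + s K`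
  explicit and summable (`0 < a < 1`, `θ′ < 1 ≤ …`, `Summable rO`, `Summable s`).
* `core` ← N19 (NE7 proper) `Spine.NE7.Core`.  NEW: dag-n19-a `…N19CoreKnit` p409134 (`core_summable_of_spineNodes`: N19 ∧ U4′ ⇐ N16 · N17
  `ScaleShiftRate` · N18 · N22 + node U2's INPUT binders + ledger; `hybridNE7_of_core_exists`∕`target_of_core_exists` = the K5 join and node U5's
  target per string), `…N19CoreKnitSanity` p409694 (the ≈45 binders jointly satisfiable with rates `< 1` and RUNNING toy couplings), dag-n19-b
  `…N19SizeWindow` p408948∕p409273 ((2.43)-faithful window profile), `…N19SizeWindowNodes` p409886 (`core_summable_of_nodes_polySize`, U2-OUTPUT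
  letter — the knit used HERE; window∕deviation binders reduced to `RecentOnly`∕`WindowMultiplicity`∕`RecentDeviation`).  At D₀: 0∕1; FIRST
  MISSING ESTIMATE (n19-a's census, ref-B READ #17 concurring): (F) the synchronised two-run TERM FORMAT at the carriers of record and
  (D) hazard H-U5b-1 — both NODE O ∕ Link content, visible below as the `hLink` hypothesis.
* K4 producers feeding `core` (all count-neutral knits over hypothesis shapes; at D₀ 0∕6): N16 dag-n16-a `…N16`∕`…N16Shape` p408904∕p409765
  (`ne3Shape_of_n16` ⇐ N05∕N07 interfaces), `…N16EndUniform` p410193; N17 dag-n17-a `…N17Knit` p408968 (`N17_of_u3edge` ⇐ (D4) ∧ N18 ∧ N22;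
  `u2Output_under_of_u3edge` and `nodeU2_of_N17` = THE EDGE N17 → N27 consumed here; negatives `not_N17_of_oscillating`), `…N17KnitEdge`;
  N18 dag-n18-a `…N18Knit` p410354 (`ne5_family_of_primitive_rate(_pencils)`), `…N18Coherence`, `…N18End`, `…N18TwoRunRecord`; N22 dag-n22-a
  `…N22Knit` p409786 (`ne9_and_fadingMemory_of_osc_smooth` …), `…N22KnitWitness` p410244, `…N22KnitDiscrete` p410615; N14 dag-n14-a
  `…N14DressedStability` p409249 (`YMDAG.N14.n14_of_uniformLeaves`), `…N14DressedWeightSlice`, `…N14TiltedAnalytic` p410577∕p411037 — N14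
  reaches N19's road as the observable-attached OTHER KINDS (`oA`, `oB`, `cO`, `RO`, `rO` below; reconciliation N14-DOSSIER §8, INBOX l.9519),
  not as a separate binder; N15 dag-n15-a `…N15Knit` (+6 modules) — reaches N16∕N17's producers, not N19 directly.
* E1∕E2 and the READING of B5: dag-n23-b `T4MatchingDegenerate` p409746 — under the prefix `HybridNE7Under D Hβ ⇔ T4ApexVariance.MatchingUnder D Hβ`
  (`hybridNE7Under_iff_matchingUnder`; the singleton expansion makes E1∕E2 identities and puts all content into `core`), so binder B5
  READS «per-string matching modulo constants of `schemeZ (D.scheme g₀) os` along the datum's tuned couplings» (ref-D READ #11: a future N27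
  claim is checked on (a) the GENUINE `schemeZ`, (b) the PINNED flow, (c) a genuine summable `δ`); `…Stage0SteeredWitness` p410662 — at Stage 0
  the tuned couplings are steerable.  Here E1∕E2 stay hypotheses (`hK5`), against the genuine `schemeZ (D.scheme g₀) os`, and the flow IS the
  datum's (`runFlow D g₀`): (a) and (b) are respected by construction, (c) is the N19 knits' explicit `δ`.
* β-side: N17's out-edge under the prefix needs, on n17-a's roads, `BetaUpperH β′ γ D.βfun ∧ γ²β′ < 1` (to run (0.20) forward along tuned runs,
  `T4TwoRunUniqueness.rgEqH_of_tuned`) and either `EventualLowerH` + window smallness (`u2Output_under_of_u3edge`) or relative analytic charts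
  (`nodeU2_of_N17`) — g0's §5 in-edge «box bounds» in a sharper form; none is a consequence of endpoint existence.
* Q8 road of record (`HistoryRealiseCellsRunApex.hybridNE7Under_of_countRoad`): unchanged since g0 (concludes `B5lit`; B5 ⇐ B5lit + `BetaPertHyp`).

HONEST FRAMING.  COMPOSITE-node bookkeeping with the children's children as hypotheses: every analytic input below is a HYPOTHESIS SHAPE of
the tree consumed BY NAME (NE3, NE4's out-edge, NE5, NE9, NE7b, NE7c — NONE printed for Bałaban's d = 4 procedure, NONE proved; the ledger
link is NODE O content); nothing of Bałaban's objects is instantiated; NO node is discharged (N27 discharges when these hypotheses are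
theorems at the carriers of record of D₀); (B) and `Hβ` are antecedents, used, never refuted; one fixed finite four-torus at fixed `ε → 0`
bookkeeping — NOT ℝ⁴, NOT infinite volume, NOT OS axioms, NOT a mass gap, NOT Clay.  Typed 28∕28 · discharged 1∕28 (N04) unchanged by this file.
Printed context = LOCATIONS only (transcribed in the imported modules' headers): [Balaban1988Convergent] CMP **119** (2.25)–(2.28) p. 259, Thm 2
(2.43) p. 263; [Balaban1987RG1] CMP **109** (0.20) p. 256, Thm 2 p. 259, p. 264; [Balaban1989LargeFieldII] CMP **122** p. 356, (1.79)–(1.89)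
pp. 383–387; [King1986] CMP **102** (3.10)–(3.13) pp. 656–657 (template of the hybrid split).  No decl below carries a cite tag.
-/

open Finset MeasureTheory

namespace Summit.QuantumFields.YangMills.Theorems.BalabanUVNodesN27SpineRecord

open Literature.MathematicalPhysics.QuantumFieldTheory.Balaban1983to89
open Literature.MathematicalPhysics.QuantumFieldTheory.Balaban1983to89.T4Continuum
open T4OutputRate T4RecentScale T4GoodClassBudget T4CauchySum T4TowerRateComposition T4TowerRateDischarge T4TermwiseBudget
open T4WeightBudget (RelWeightBound)
open T4IndicatorShell (ShellWeightBound)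
open T4MatchingAssembly (HybridNE7 StringHybridNE7)
open T4EtaRateMin (Readings NE3Shape)
open T4RateLiaison (GaugeDominated)
open T4ContinuumYM4Torus (ForSmallCouplings)
open Summit.QuantumFields.BalabanUV.T4Continuum.Spine
open Summit.QuantumFields.BalabanUV.T4Continuum.Spine.NE4 (NE4OnData U2Output runFlow)
open Summit.QuantumFields.YangMills.BalabanUVNodes.N19SizeWindow (core_summable_of_nodes_polySize)

/-! ## §3 (used first) Node U2's output restricts to the runs from an offset on -/

/-- **OFFSET BOOKKEEPING.**  A `K`-uniform injected rate (`T4CauchySum.InjectedRate C 0 θ`, exponent `0`: no growth in the cutoff) for a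
two-index family restricts to the family re-based at `K₀`: the runs `K₀ + K`, `K ≥ 0`. [bookkeeping] [folklore] -/
theorem injectedRate_shift {Cc θ : ℝ} {inj : ℕ → ℕ → ℝ} (h : InjectedRate Cc 0 θ inj) (K₀ : ℕ) :
    InjectedRate Cc 0 θ fun K j => inj (K₀ + K) j := by
  intro K j hj
  have h' := h (K₀ + K) j (hj.trans (Nat.le_add_left K K₀))
  simp only [pow_zero, mul_one] at h' ⊢
  exact h'

/-! ## §1 One string, explicit carriers: the spine's record decls + N17's out-edge + the ledger link ⇒ `StringHybridNE7` -/

section Scheme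

variable {G : Type*} [GaugeGroup G] [MeasurableSpace G] [HaarData G] {O : Type*}
  {C : Carriers} {ι X : Type} [MeasurableSpace ι] {σ : Type} [DecidableEq σ] {l₀ vol : ℝ}
  {T : ℕ → Finset σ} {Bad : ℕ → ℝ → Finset σ} {A B shA shB : ℕ → ℝ → σ → ℝ} {W Wsh : ℕ → ℝ}
  {μ : ℕ → ℝ → σ → Measure ι} {fac : ℕ → ℝ → σ → Finset C.Dom} {R : Readings ι X} {Wset : Set (ℕ → ℝ)}
  {EA : Functional C C.BgA} {EB : Functional C C.BgB} {κ θ₅ C₅ C₉ ω θc Cd γ C₃ θ₃ P θ' : ℝ} {q : ℕ} {Λm : ℕ → ℕ → ℝ}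
  {CU : (ℕ → ℝ) → ℕ → ℝ} {g : ℕ → ℕ → ℝ} {uA : ℕ → ι → C.BgA} {uB : ℕ → ι → C.BgB} {oneA : C.BgA} {oneB : C.BgB}
  {oA oB : ℕ → ℝ → σ → ι → ℝ} {κ₁ Ssz : ℕ → ℝ → σ → ℕ → ℝ} {cO RO : ℕ → ℝ → σ → ℝ} {rO : ℕ → ℝ} {Cw a Λ E₀ : ℝ} {m : ℕ}

/-- **ONE STRING: N19 ∧ U4′ OPAQUE, IN THE FORM THE N19 KNITS DELIVER IT.**  N20 `RelWeightBound` · N21 `ShellWeightBound` · `W + Wsh < 1`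
· `∃ δ, Spine.NE7.Core … δ ∧ Summable δ` on the shell-free cores (verbatim the conclusion of `N19CoreKnit.core_summable_of_spineNodes` ∕
`N19SizeWindow.core_summable_of_nodes_polySize`) · E1∕E2 against the string's dressed partition functions from `K₀` on ⇒
`StringHybridNE7 S os l₀ vol K₀`.  (`Spine.NE7.hybridNE7_of_core`; the `∃ δ`-variant of g0's `stringHybridNE7_of_spineNodes`.)
[bookkeeping] [folklore] -/
theorem stringHybridNE7_of_spineNodes_exists (S : Missing.TorusScheme G O) (os : List O) (K₀ : ℕ)
    (h20 : RelWeightBound l₀ T A B Bad W) (h21 : ShellWeightBound l₀ T A B shA shB Wsh) (hlt : ∀ K, W K + Wsh K < 1)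
    (h19 : ∃ δ : ℕ → ℝ,
      NE7.Core l₀ vol T Bad (fun K t τ => A K t τ - shA K t τ) (fun K t τ => B K t τ - shB K t τ) δ ∧ Summable δ)
    (hE1 : ∀ (K : ℕ) (t : ℝ), |t| ≤ l₀ → T4GenFunBounds.schemeZ S os (K₀ + K) t = ∑ τ ∈ T K, A K t τ)
    (hE2 : ∀ (K : ℕ) (t : ℝ), |t| ≤ l₀ → T4GenFunBounds.schemeZ S os (K₀ + K + 1) t = ∑ τ ∈ T K, B K t τ) :
    StringHybridNE7 S os l₀ vol K₀ := by
  obtain ⟨δ, hcore, hδ⟩ := h19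
  exact ⟨σ, ‹_›, T, A, B, shA, shB, Bad, W, Wsh, δ, NE7.hybridNE7_of_core h20 h21 hlt hδ hcore, hE1, hE2⟩

/-- **ONE STRING FROM THE SPINE'S RECORD DECLS, N17 IN NODE U2's OUTPUT LETTER.**  Explicit carriers: class index `σ`, classes `T K`,
term weights `A`, `B`, shells `shA`, `shB`, bad classes `Bad`, weights `W`, `Wsh`; the (2.25)-ledger (`μ`, `fac`, other kinds `oA`,
`oB`, size centring `κ₁`, `Ssz`, other kinds' centring `cO`, `RO`, aggregate `rO`) on node U3's carriers `C` with functionals `EA`, `EB`,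
NE3's readings `R`, backgrounds `uA`, `uB`, references `oneA`, `oneB`, coupling window `Wset`; run A at cutoff `K₀ + K` has the coupling
table `g K`, run B the re-indexed `i ↦ g (K+1) (i+1)`.  HYPOTHESES, grouped: (K5) `h20` N20 = NE7b, `h21` N21 = NE7c, `hlt`; (E) `hE1`,
`hE2`; (K4, record decls) `h16` N16 = `NE3Shape R C₃ θ₃` with the liaison `hgd`, `h18` N18 = `NE5`, `h22` N22 = `NE9 ∧ FadingMemory`, node
U3's printed-ingredient bracket `hUL`, `hG`; (N17's out-edge) `hinj : InjectedRate Cd 0 θc (disc (g K) (g (K+1)))` — node U2's OUTPUT, which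
dag-n17-a's `N17Knit` produces under the prefix from `NE4OnData D` —, the box `hbox`, the window memberships `hgA`, `hgB`, the rate
ordering; (Link) the term format OF THE SHELL-FREE CORES `A − shA`, `B − shB`, `hint`, `hsc`, `hposO`, `hoff`, `hS`, `hM`, `hO`, the window
profile `hSle`, `hRO`, `hrO`, and hazard H-U5b-1 `hdevU` asked UNIFORMLY in the tower constant.  CONCLUSION: `StringHybridNE7 S os l₀ vol K₀`.
PROOF: `N19SizeWindow.core_summable_of_nodes_polySize` (with `h16.pointwise`, `h16.rate_nonneg`, `h16.rate_lt_one`) gives the tower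
constant `Cr ≥ 0`; `hdevU Cr` the centres; whence `Core ∧ Summable δ`; then `stringHybridNE7_of_spineNodes_exists`.  CONDITIONAL on every
binder; NE7∕NE7b∕NE7c NOT PRINTED, NOT proved. [bookkeeping] [folklore] -/
theorem stringHybridNE7_of_spineRecord (S : Missing.TorusScheme G O) (os : List O) (K₀ : ℕ)
    -- K5: N20, N21, the budget
    (h20 : RelWeightBound l₀ T A B Bad W) (h21 : ShellWeightBound l₀ T A B shA shB Wsh) (hlt : ∀ K, W K + Wsh K < 1)
    -- E1∕E2
    (hE1 : ∀ (K : ℕ) (t : ℝ), |t| ≤ l₀ → T4GenFunBounds.schemeZ S os (K₀ + K) t = ∑ τ ∈ T K, A K t τ)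
    (hE2 : ∀ (K : ℕ) (t : ℝ), |t| ≤ l₀ → T4GenFunBounds.schemeZ S os (K₀ + K + 1) t = ∑ τ ∈ T K, B K t τ)
    -- K4 by name: N22, node U3's bracket, N18, N16 (+ liaison)
    (h22 : NE9 EA Wset κ Λm ∧ FadingMemory C₉ ω Λm) (hω : 0 ≤ ω)
    (hUL : LipBackground EA Wset κ CU) (hG : PolyLipGrowth CU g P q) (hP : 0 ≤ P)
    (h18 : NE5 EA EB Wset κ θ₅ C₅) (hθ₅ : 0 ≤ θ₅) (hC₅ : 0 ≤ C₅)
    (h16 : NE3Shape R C₃ θ₃) (hC₃ : 0 ≤ C₃) (hgd : GaugeDominated R uA uB)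
    -- N17's out-edge in node U2's OUTPUT letter, the box, the windows, the rate ordering
    (hinj : InjectedRate Cd 0 θc (fun K j => T4CouplingMatching.disc (g K) (g (K + 1)) j)) (hCd : 0 ≤ Cd)
    (hθc : 0 ≤ θc) (hbox : ∀ K i, i ≤ K → 0 < g K i ∧ g K i ≤ γ)
    (hgA : ∀ K, g K ∈ Wset) (hgB : ∀ K, (fun i => g (K + 1) (i + 1)) ∈ Wset)
    (hθ' : max ω θc < θ') (hθ₅' : θ₅ ≤ θ') (hθ₃' : θ₃ ≤ θ') (hθ'1 : θ' < 1) (hθ'Λ : θ' ≤ Λ)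
    -- the (2.25)-ledger link, on the shell-free cores
    (hfmtA : ∀ K t τ, A K t τ - shA K t τ = ∫ v, (∏ Y ∈ fac K t τ,
      Real.exp (EA (g K) (uA K v) Y - EA (g K) oneA Y)) * oA K t τ v ∂(μ K t τ))
    (hfmtB : ∀ K t τ, B K t τ - shB K t τ = ∫ v, (∏ Y ∈ fac K t τ,
      Real.exp (EB (fun i => g (K + 1) (i + 1)) (uB K v) Y - EB (fun i => g (K + 1) (i + 1)) oneB Y)) *
        oB K t τ v ∂(μ K t τ))
    (hint : ∀ K t, |t| ≤ l₀ → ∀ τ ∈ T K \ Bad K t,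
      Integrable (fun v => (∏ Y ∈ fac K t τ, Real.exp (EA (g K) (uA K v) Y - EA (g K) oneA Y)) *
        oA K t τ v) (μ K t τ) ∧
      Integrable (fun v => (∏ Y ∈ fac K t τ,
        Real.exp (EB (fun i => g (K + 1) (i + 1)) (uB K v) Y - EB (fun i => g (K + 1) (i + 1)) oneB Y)) *
        oB K t τ v) (μ K t τ))
    (hsc : ∀ K t, |t| ≤ l₀ → ∀ τ ∈ T K \ Bad K t, ∀ Y ∈ fac K t τ, C.scale Y ≤ K)
    (hposO : ∀ K t, |t| ≤ l₀ → ∀ τ ∈ T K \ Bad K t, ∀ v ∈ R.dom, 0 < oA K t τ v ∧ 0 < oB K t τ v)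
    (hoff : ∀ K t, |t| ≤ l₀ → ∀ τ ∈ T K \ Bad K t, ∀ v, v ∉ R.dom →
      (∏ Y ∈ fac K t τ, Real.exp (EA (g K) (uA K v) Y - EA (g K) oneA Y)) * oA K t τ v = 0 ∧
      (∏ Y ∈ fac K t τ,
        Real.exp (EB (fun i => g (K + 1) (i + 1)) (uB K v) Y - EB (fun i => g (K + 1) (i + 1)) oneB Y)) *
        oB K t τ v = 0)
    (hS : ∀ K t, |t| ≤ l₀ → ∀ τ ∈ T K \ Bad K t, ∀ v ∈ R.dom, ∀ j ≤ K,
      |(∑ Y ∈ fac K t τ with C.scale Y = j,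
          (Real.log (Real.exp (EB (fun i => g (K + 1) (i + 1)) (uB K v) Y
              - EB (fun i => g (K + 1) (i + 1)) oneB Y))
            - Real.log (Real.exp (EA (g K) (uA K v) Y - EA (g K) oneA Y)))) - κ₁ K t τ j| ≤ Ssz K t τ j)
    (hM : ∀ K t, |t| ≤ l₀ → ∀ τ ∈ T K \ Bad K t,
      Multiplicity (fac K t τ) C.scale (fun Y => Real.exp (-(κ * C.d Y))) Cw vol Λ K)
    (hO : ∀ K t, |t| ≤ l₀ → ∀ τ ∈ T K \ Bad K t, ∀ v ∈ R.dom,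
      |Real.log (oB K t τ v) - Real.log (oA K t τ v) - cO K t τ| ≤ RO K t τ)
    (hvol : 0 < vol) (hE₀ : 0 ≤ E₀) (ha0 : 0 < a) (ha1 : a < 1)
    (hSle : ∀ K t, |t| ≤ l₀ → ∀ τ ∈ T K \ Bad K t, ∀ j ≤ K,
      Ssz K t τ j ≤ vol * (E₀ * ((K : ℝ) + 1) ^ m * a ^ (K - j)))
    (hRO : ∀ K t, |t| ≤ l₀ → ∀ τ ∈ T K \ Bad K t, RO K t τ ≤ vol * rO K) (hrO : Summable rO)
    (hdevU : ∀ Cr : ℝ, 0 ≤ Cr → ∃ c₀ s : ℕ → ℝ, Summable s ∧ ∀ K t, |t| ≤ l₀ → ∀ τ ∈ T K \ Bad K t,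
      |((∑ j ∈ range (K + 1), sliceCentre (κ₁ K t τ)
          (fun j => ∑ Y ∈ fac K t τ with C.scale Y = j,
            (-(EB (fun i => g (K + 1) (i + 1)) oneB Y - EA (g K) oneA Y)))
          (Ssz K t τ) (fun j => Cw * vol * (Cr * θ' ^ j * Λ ^ (K - j))) j) + cO K t τ) - c₀ K| ≤ vol * s K) :
    StringHybridNE7 S os l₀ vol K₀ := by
  obtain ⟨Cr, hCr, hknit⟩ := core_summable_of_nodes_polySize (A := fun K t τ => A K t τ - shA K t τ)
    (B := fun K t τ => B K t τ - shB K t τ) h22.1 h22.2 hω hUL hG hP h18 hθ₅ hC₅ h16.pointwise hC₃ h16.rate_nonneg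
    h16.rate_lt_one hgd hinj hCd hθc hbox hgA hgB hθ' hθ₅' hθ₃' hfmtA hfmtB hint hsc hposO hoff hS hM hO hvol.le hE₀ ha0
    ha1 hθ'1 hθ'Λ hSle hRO hrO
  obtain ⟨c₀, s, hs, hdev⟩ := hdevU Cr hCr
  exact stringHybridNE7_of_spineNodes_exists S os K₀ h20 h21 hlt ⟨_, hknit c₀ s hs hdev⟩ hE1 hE2

end Scheme

/-! ## §2 THE N27 JOIN AT THE DATUM: the record decls by name, N17's out-edge under the prefix, everything at the datum's runs -/

section Datum

variable {F : T4Family} {G : Type*} [GaugeGroup G] [MeasurableSpace G] [HaarData G]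
  {C : Carriers} {ι X : Type} [MeasurableSpace ι] {σ : Type} [DecidableEq σ]
  -- string-independent K4 data (the record decls' own letters)
  {R : Readings ι X} {Wset : Set (ℕ → ℝ)} {EA : Functional C C.BgA} {EB : Functional C C.BgB}
  {κ θ₅ C₅ C₉ ω C₃ θ₃ P θ' Cw a Λ E₀ : ℝ} {q m : ℕ} {Λm : ℕ → ℕ → ℝ} {CU : (ℕ → ℝ) → ℕ → ℝ}
  {uA : ℕ → ι → C.BgA} {uB : ℕ → ι → C.BgB} {oneA : C.BgA} {oneB : C.BgB}
  -- per-(tuned sequence, string) K5 ∕ ledger carriers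
  {l₀ vol : (ℕ → ℝ) → List (ULoop F) → ℝ} {K₀ : (ℕ → ℝ) → List (ULoop F) → ℕ}
  {T : (ℕ → ℝ) → List (ULoop F) → ℕ → Finset σ} {Bad : (ℕ → ℝ) → List (ULoop F) → ℕ → ℝ → Finset σ}
  {A B shA shB : (ℕ → ℝ) → List (ULoop F) → ℕ → ℝ → σ → ℝ} {W Wsh rO : (ℕ → ℝ) → List (ULoop F) → ℕ → ℝ}
  {μ : (ℕ → ℝ) → List (ULoop F) → ℕ → ℝ → σ → Measure ι} {fac : (ℕ → ℝ) → List (ULoop F) → ℕ → ℝ → σ → Finset C.Dom}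
  {oA oB : (ℕ → ℝ) → List (ULoop F) → ℕ → ℝ → σ → ι → ℝ} {κ₁ Ssz : (ℕ → ℝ) → List (ULoop F) → ℕ → ℝ → σ → ℕ → ℝ}
  {cO RO : (ℕ → ℝ) → List (ULoop F) → ℕ → ℝ → σ → ℝ}

/-- **N27 = B5 AT THE DATUM FROM THE SPINE'S RECORD DECLS (any finite-`ε` datum `D`, any β-binder `Hβ`; N17 as its out-edge).**
TOP LEVEL, BY NAME: N16 `h16 : NE3Shape R C₃ θ₃` (+ liaison `hgd`), N18 `h18 : NE5 EA EB Wset κ θ₅ C₅`, N22 `h22 : NE9 EA Wset κ Λm ∧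
FadingMemory C₉ ω Λm`, node U3's Lipschitz-in-the-background `hUL`, the letter signs and the rate ordering `max ω θc < θ′ < 1`, `θ₅, θ₃ ≤ θ′
≤ Λ`, `0 < a < 1`.  UNDER THE TARGETS' PREFIX (each its own `D.UnderHypotheses Hβ`, thresholds conjoined inside the proof):
`hU2` — THE EDGE N17 → N27 in node U2's output letter, `Spine.NE4.U2Output D g₀ Cd θc` (dag-n17-a `N17Knit.u2Output_under_of_u3edge` ∕
`nodeU2_of_N17` conclude exactly this); `hK5` — per string `os`, at the carriers `(T, Bad, A, B, shA, shB, W, Wsh)(g₀, os)` with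
`0 < l₀`, `0 < vol`: N20 `RelWeightBound`, N21 `ShellWeightBound`, the budget `W + Wsh < 1`, and the E1∕E2 dictionary against
`T4GenFunBounds.schemeZ (D.scheme g₀) os (K₀ + K)` ∕ `(K₀ + K + 1)`; `hRuns` — the run-dependent K4 clauses AT THE DATUM'S RUNS
`g K := Spine.NE4.runFlow D g₀ (K₀ + K)`: `PolyLipGrowth CU g P q` and the window memberships of both runs' tables; `hLink` — the
(2.25)-ledger link at those runs (term format of the shell-free cores, integrability, scales, other kinds, size window
`Ssz ≤ vol·E₀(K+1)^m·a^{K−j}`, multiplicity, `RO ≤ vol·rO`, `Summable rO`, hazard H-U5b-1 uniformly in the tower constant).  The box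
`0 < g K i ≤ γ` (`i ≤ K`) is NOT asked: it is `D.Tuned γ g g₀` at the run `K₀ + K` (`Setup.Flow.InInterval`).  CONCLUSION:
`T4ApexHybrid.HybridNE7Under D Hβ` — at `Hβ := DagBinding.EndpointExistence D.C.toB12` the venue's `YMDAG.B5 D`.  PROOF: unfold the prefix,
`ForSmallCouplings.and` thrice, per tuned `g₀` and string: `injectedRate_shift` re-bases N17's out-edge at `K₀`, the box from `Tuned`, §1.
CONDITIONAL on every binder; nothing of Bałaban's instantiated; NOT a discharge. [bookkeeping] [folklore] -/
theorem hybridNE7Under_of_spineRecordAtDatum (D : FiniteEpsData F G) {Hβ : Prop} {Cd θc : ℝ}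
    -- K4 record decls, string-independent, BY NAME
    (h16 : NE3Shape R C₃ θ₃) (hC₃ : 0 ≤ C₃) (hgd : GaugeDominated R uA uB)
    (h18 : NE5 EA EB Wset κ θ₅ C₅) (hθ₅ : 0 ≤ θ₅) (hC₅ : 0 ≤ C₅)
    (h22 : NE9 EA Wset κ Λm ∧ FadingMemory C₉ ω Λm) (hω : 0 ≤ ω)
    (hUL : LipBackground EA Wset κ CU) (hP : 0 ≤ P)
    (hθ' : max ω θc < θ') (hθ₅' : θ₅ ≤ θ') (hθ₃' : θ₃ ≤ θ') (hθ'1 : θ' < 1) (hθ'Λ : θ' ≤ Λ)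
    (hE₀ : 0 ≤ E₀) (ha0 : 0 < a) (ha1 : a < 1) (hCd : 0 ≤ Cd) (hθc : 0 ≤ θc)
    -- THE EDGE N17 → N27: node U2's output under the prefix (n17-a's conclusion verbatim)
    (hU2 : D.UnderHypotheses Hβ fun g₀ => U2Output D g₀ Cd θc)
    -- K5 per string at the carriers of `(g₀, os)`: N20, N21, budget, E1∕E2
    (hK5 : D.UnderHypotheses Hβ fun g₀ => ∀ os : List (ULoop F),
      0 < l₀ g₀ os ∧ 0 < vol g₀ os ∧
        RelWeightBound (l₀ g₀ os) (T g₀ os) (A g₀ os) (B g₀ os) (Bad g₀ os) (W g₀ os) ∧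
        ShellWeightBound (l₀ g₀ os) (T g₀ os) (A g₀ os) (B g₀ os) (shA g₀ os) (shB g₀ os) (Wsh g₀ os) ∧
        (∀ K, W g₀ os K + Wsh g₀ os K < 1) ∧
        (∀ (K : ℕ) (t : ℝ), |t| ≤ l₀ g₀ os →
          T4GenFunBounds.schemeZ (D.scheme g₀) os (K₀ g₀ os + K) t = ∑ τ ∈ T g₀ os K, A g₀ os K t τ) ∧
        (∀ (K : ℕ) (t : ℝ), |t| ≤ l₀ g₀ os →
          T4GenFunBounds.schemeZ (D.scheme g₀) os (K₀ g₀ os + K + 1) t = ∑ τ ∈ T g₀ os K, B g₀ os K t τ))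
    -- the run-dependent K4 clauses at the datum's runs
    (hRuns : D.UnderHypotheses Hβ fun g₀ => ∀ os : List (ULoop F),
      PolyLipGrowth CU (fun K => runFlow D g₀ (K₀ g₀ os + K)) P q ∧
        (∀ K, runFlow D g₀ (K₀ g₀ os + K) ∈ Wset) ∧
        (∀ K, (fun i => runFlow D g₀ (K₀ g₀ os + (K + 1)) (i + 1)) ∈ Wset))
    -- the (2.25)-ledger link at the datum's runs
    (hLink : D.UnderHypotheses Hβ fun g₀ => ∀ os : List (ULoop F),
      (∀ K t τ, A g₀ os K t τ - shA g₀ os K t τ = ∫ v, (∏ Y ∈ fac g₀ os K t τ,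
        Real.exp (EA (runFlow D g₀ (K₀ g₀ os + K)) (uA K v) Y - EA (runFlow D g₀ (K₀ g₀ os + K)) oneA Y)) *
          oA g₀ os K t τ v ∂(μ g₀ os K t τ)) ∧
      (∀ K t τ, B g₀ os K t τ - shB g₀ os K t τ = ∫ v, (∏ Y ∈ fac g₀ os K t τ,
        Real.exp (EB (fun i => runFlow D g₀ (K₀ g₀ os + (K + 1)) (i + 1)) (uB K v) Y
          - EB (fun i => runFlow D g₀ (K₀ g₀ os + (K + 1)) (i + 1)) oneB Y)) * oB g₀ os K t τ v ∂(μ g₀ os K t τ)) ∧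
      (∀ K t, |t| ≤ l₀ g₀ os → ∀ τ ∈ T g₀ os K \ Bad g₀ os K t,
        Integrable (fun v => (∏ Y ∈ fac g₀ os K t τ,
          Real.exp (EA (runFlow D g₀ (K₀ g₀ os + K)) (uA K v) Y - EA (runFlow D g₀ (K₀ g₀ os + K)) oneA Y)) *
            oA g₀ os K t τ v) (μ g₀ os K t τ) ∧
        Integrable (fun v => (∏ Y ∈ fac g₀ os K t τ,
          Real.exp (EB (fun i => runFlow D g₀ (K₀ g₀ os + (K + 1)) (i + 1)) (uB K v) Y
            - EB (fun i => runFlow D g₀ (K₀ g₀ os + (K + 1)) (i + 1)) oneB Y)) * oB g₀ os K t τ v) (μ g₀ os K t τ)) ∧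
      (∀ K t, |t| ≤ l₀ g₀ os → ∀ τ ∈ T g₀ os K \ Bad g₀ os K t, ∀ Y ∈ fac g₀ os K t τ, C.scale Y ≤ K) ∧
      (∀ K t, |t| ≤ l₀ g₀ os → ∀ τ ∈ T g₀ os K \ Bad g₀ os K t, ∀ v ∈ R.dom,
        0 < oA g₀ os K t τ v ∧ 0 < oB g₀ os K t τ v) ∧
      (∀ K t, |t| ≤ l₀ g₀ os → ∀ τ ∈ T g₀ os K \ Bad g₀ os K t, ∀ v, v ∉ R.dom →
        (∏ Y ∈ fac g₀ os K t τ,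
          Real.exp (EA (runFlow D g₀ (K₀ g₀ os + K)) (uA K v) Y - EA (runFlow D g₀ (K₀ g₀ os + K)) oneA Y)) *
            oA g₀ os K t τ v = 0 ∧
        (∏ Y ∈ fac g₀ os K t τ,
          Real.exp (EB (fun i => runFlow D g₀ (K₀ g₀ os + (K + 1)) (i + 1)) (uB K v) Y
            - EB (fun i => runFlow D g₀ (K₀ g₀ os + (K + 1)) (i + 1)) oneB Y)) * oB g₀ os K t τ v = 0) ∧
      (∀ K t, |t| ≤ l₀ g₀ os → ∀ τ ∈ T g₀ os K \ Bad g₀ os K t, ∀ v ∈ R.dom, ∀ j ≤ K,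
        |(∑ Y ∈ fac g₀ os K t τ with C.scale Y = j,
            (Real.log (Real.exp (EB (fun i => runFlow D g₀ (K₀ g₀ os + (K + 1)) (i + 1)) (uB K v) Y
                - EB (fun i => runFlow D g₀ (K₀ g₀ os + (K + 1)) (i + 1)) oneB Y))
              - Real.log (Real.exp (EA (runFlow D g₀ (K₀ g₀ os + K)) (uA K v) Y
                - EA (runFlow D g₀ (K₀ g₀ os + K)) oneA Y)))) - κ₁ g₀ os K t τ j| ≤ Ssz g₀ os K t τ j) ∧
      (∀ K t, |t| ≤ l₀ g₀ os → ∀ τ ∈ T g₀ os K \ Bad g₀ os K t,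
        Multiplicity (fac g₀ os K t τ) C.scale (fun Y => Real.exp (-(κ * C.d Y))) Cw (vol g₀ os) Λ K) ∧
      (∀ K t, |t| ≤ l₀ g₀ os → ∀ τ ∈ T g₀ os K \ Bad g₀ os K t, ∀ v ∈ R.dom,
        |Real.log (oB g₀ os K t τ v) - Real.log (oA g₀ os K t τ v) - cO g₀ os K t τ| ≤ RO g₀ os K t τ) ∧
      (∀ K t, |t| ≤ l₀ g₀ os → ∀ τ ∈ T g₀ os K \ Bad g₀ os K t, ∀ j ≤ K,
        Ssz g₀ os K t τ j ≤ vol g₀ os * (E₀ * ((K : ℝ) + 1) ^ m * a ^ (K - j))) ∧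
      (∀ K t, |t| ≤ l₀ g₀ os → ∀ τ ∈ T g₀ os K \ Bad g₀ os K t, RO g₀ os K t τ ≤ vol g₀ os * rO g₀ os K) ∧
      Summable (rO g₀ os) ∧
      (∀ Cr : ℝ, 0 ≤ Cr → ∃ c₀ s : ℕ → ℝ, Summable s ∧ ∀ K t, |t| ≤ l₀ g₀ os → ∀ τ ∈ T g₀ os K \ Bad g₀ os K t,
        |((∑ j ∈ range (K + 1), sliceCentre (κ₁ g₀ os K t τ)
            (fun j => ∑ Y ∈ fac g₀ os K t τ with C.scale Y = j,
              (-(EB (fun i => runFlow D g₀ (K₀ g₀ os + (K + 1)) (i + 1)) oneB Y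
                - EA (runFlow D g₀ (K₀ g₀ os + K)) oneA Y)))
            (Ssz g₀ os K t τ) (fun j => Cw * vol g₀ os * (Cr * θ' ^ j * Λ ^ (K - j))) j) + cO g₀ os K t τ) - c₀ K|
          ≤ vol g₀ os * s K)) :
    T4ApexHybrid.HybridNE7Under D Hβ := by
  intro hB hβ
  have H1 : ForSmallCouplings D _ := hU2 hB hβ
  have H2 : ForSmallCouplings D _ := hK5 hB hβ
  have H3 : ForSmallCouplings D _ := hRuns hB hβ
  have H4 : ForSmallCouplings D _ := hLink hB hβ
  obtain ⟨γ₀, hγ₀, Hγ⟩ := ((H1.and H2).and H3).and H4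
  refine ⟨γ₀, hγ₀, fun γ hγ hγle => ?_⟩
  obtain ⟨g₁, hg₁, Hg⟩ := Hγ γ hγ hγle
  refine ⟨g₁, hg₁, fun g hg hgle g₀ ht os => ?_⟩
  obtain ⟨⟨⟨hu2, hk5⟩, hruns⟩, hlink⟩ := Hg g hg hgle g₀ ht
  obtain ⟨hl₀, hvol, h20, h21, hlt, hE1, hE2⟩ := hk5 os
  obtain ⟨hG, hgA, hgB⟩ := hruns os
  obtain ⟨hfmtA, hfmtB, hint, hsc, hposO, hoff, hS, hM, hO, hSle, hRO, hrO, hdevU⟩ := hlink os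
  -- the box of both runs' tables, READ OFF `Tuned` at the run `K₀ + K`
  have hbox : ∀ K i, i ≤ K →
      0 < runFlow D g₀ (K₀ g₀ os + K) i ∧ runFlow D g₀ (K₀ g₀ os + K) i ≤ γ := fun K i hi =>
    (ht (K₀ g₀ os + K)).1 i (hi.trans (Nat.le_add_left K (K₀ g₀ os)))
  -- N17's out-edge re-based at `K₀`
  have hinj : InjectedRate Cd 0 θc fun K j =>
      T4CouplingMatching.disc (runFlow D g₀ (K₀ g₀ os + K)) (runFlow D g₀ (K₀ g₀ os + (K + 1))) j :=
    injectedRate_shift hu2 (K₀ g₀ os)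
  exact ⟨l₀ g₀ os, vol g₀ os, K₀ g₀ os, hl₀, hvol,
    stringHybridNE7_of_spineRecord (g := fun K => runFlow D g₀ (K₀ g₀ os + K)) (D.scheme g₀) os (K₀ g₀ os) h20 h21 hlt
      hE1 hE2 h22 hω hUL hG hP h18 hθ₅ hC₅ h16 hC₃ hgd hinj hCd hθc hbox hgA hgB hθ' hθ₅' hθ₃' hθ'1 hθ'Λ hfmtA hfmtB
      hint hsc hposO hoff hS hM hO hvol hE₀ ha0 ha1 hSle hRO hrO hdevU⟩

end Datum

end Summit.QuantumFields.YangMills.Theorems.BalabanUVNodesN27SpineRecord
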